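import Summits.NavierStokesRegularity.FluidComputer.RiccatiSummationGen
import HarnessLib

/-!
# Fluid computer — support: tools for the `4^{sj}`-weighted block balance of one slice, `3/2 < s < 5/2`
# (fourth-order tails, Hölder over the levels, Young with an `ε`)

HONEST FRAMING (cell `pub-fluidc`, verbatim): *low prior, high value-of-information experiment on Tao's
machine paradigm; NOT a claim that NS blows up.* Support file (successor of `RiccatiSlice`, which is the case
`s = 3/2`). For ONE smooth, divergence-free, finite-energy field `w` on `ℝ³`, `a_l = ‖Δ̇_l w‖₂`, and a weight `κ = 2s`,
`3 < κ < 5`: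

* `two_pow_four_mul_blockL2_le`, `tsum_weighted_sq_le_window_add'` — `2^{4l} a_l ≤ C_r⁴ C₂ ∑_i T₃(∂_i w)` (fourth
  derivatives through the third-derivative sums of the first derivatives) and the UNIFORM tails of every row
  `∑_l 2^{κ'l} a_l²`, `1 ≤ κ' ≤ 7`, on windows where `∑_i T₃(∂_i w) ≤ S₄` and `‖w‖₂ ≤ E₀` (the dissipation row
  `D_κ = ∑ 2^{(κ+2)l} a_l²` has `κ + 2 < 7`);
* `tsum_five_le_rpow_mul_rpow` — Hölder over the levels: `∑ 32^l a_l² ≤ (∑ 2^{κl} a_l²)^{(κ−3)/2} (∑ 2^{(κ+2)l} a_l²)^{(5−κ)/2}`;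
* `young_rpow` — `U V^{α/2} ≤ ε V + ε^{−α/(2−α)} U^{2/(2−α)}` for reals;
(the consumer is `RiccatiSliceGen.weighted_slice_le_gen`, the Riccati integrand of Cheskidov–Zaya's Remark 2.3 for one
slice).

0 sorry; no definitions; no named facts.

## References

* A. Cheskidov, K. Zaya, J. Math. Phys. 57 (2016) 023101 = arXiv:1503.01784, Remark 2.3 (p. 6). [CheskidovZaya2016]
* A. Cheskidov, M. Dai, arXiv:1507.06611, §3.1 (3.6). [CheskidovDai2015]
-/

noncomputable section

open MeasureTheory Set Function Filter Topology
open scoped ENNReal NNReal RealInnerProductSpace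
open Literature.Analysis.FluidPDE Literature.Analysis.FunctionSpaces
open Literature.Analysis.FluidPDE.LPBounds (thirdSum)
open Summit.NavierStokesRegularity.FluidComputer.RiccatiSummationGen
open Summit.NavierStokesRegularity.FluidComputer.RiccatiSlice
open Summit.NavierStokesRegularity.FluidComputer.BlockEnergyIdentity
open Summit.NavierStokesRegularity.FluidComputer.BlockAmplitudeCeiling

namespace Summit.NavierStokesRegularity.FluidComputer.RiccatiSliceGenTools

/-! ## Fourth-order block decay and the uniform tails up to weight `2^{7l}` -/

/-- **`2^{4l} ‖Δ̇_l w‖₂ ≤ C_r⁴ C₂ · ∑_i T₃(∂_i w)`** for a smooth `L²` field: reverse Bernstein `2^l a_l ≤ C_r ∑_i ‖Δ̇_l ∂_i w‖₂`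
and `RiccatiSlice.two_pow_three_mul_blockL2_le` for each derivative field `∂_i w`.
[cite: BahouriCheminDanchin2011, Lemma 2.1] -/
theorem two_pow_four_mul_blockL2_le {w : EuclideanSpace ℝ (Fin 3) → EuclideanSpace ℝ (Fin 3)}
    (hw : IsSmoothL2Field w) (l : ℤ) :
    ((2 : ℝ≥0∞) ^ l) ^ 4 * blockL2 w l ≤
      ((lpBounds (Fin 3)).Cr : ℝ≥0∞) ^ 4 * (lpBounds (Fin 3)).C₂ *
        ∑ i, thirdSum (fun x => fderiv ℝ w x (stdOrthonormalBasis ℝ (EuclideanSpace ℝ (Fin 3)) i)) := by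
  set K := lpBounds (Fin 3) with hK
  set e := stdOrthonormalBasis ℝ (EuclideanSpace ℝ (Fin 3)) with he
  have h1 := K.two_zpow_mul_blockL2_le hw l
  have hgrad : blockGrad w l = ∑ i, blockL2 (fun x => fderiv ℝ w x (e i)) l := by
    unfold blockGrad blockL2
    exact Finset.sum_congr rfl fun i _ => LPBounds.eLpNorm_fderiv_blockFn_eq hw l (e i)
  have h3 : ∀ i, ((2 : ℝ≥0∞) ^ l) ^ 3 * blockL2 (fun x => fderiv ℝ w x (e i)) l ≤
      (K.Cr : ℝ≥0∞) ^ 3 * K.C₂ * thirdSum (fun x => fderiv ℝ w x (e i)) := fun i =>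
    two_pow_three_mul_blockL2_le (hw.fderiv_apply (e i)) l
  calc ((2 : ℝ≥0∞) ^ l) ^ 4 * blockL2 w l = ((2 : ℝ≥0∞) ^ l) ^ 3 * ((2 : ℝ≥0∞) ^ l * blockL2 w l) := by ring
    _ ≤ ((2 : ℝ≥0∞) ^ l) ^ 3 * (K.Cr * blockGrad w l) := by gcongr
    _ = K.Cr * ∑ i, ((2 : ℝ≥0∞) ^ l) ^ 3 * blockL2 (fun x => fderiv ℝ w x (e i)) l := by
        rw [hgrad, Finset.mul_sum, Finset.mul_sum, Finset.mul_sum]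
        exact Finset.sum_congr rfl fun i _ => by ring
    _ ≤ K.Cr * ∑ i, (K.Cr : ℝ≥0∞) ^ 3 * K.C₂ * thirdSum (fun x => fderiv ℝ w x (e i)) :=
        mul_le_mul_right (Finset.sum_le_sum fun i _ => h3 i) _
    _ = (K.Cr : ℝ≥0∞) ^ 4 * K.C₂ * ∑ i, thirdSum (fun x => fderiv ℝ w x (e i)) := by
        rw [Finset.mul_sum, Finset.mul_sum]
        exact Finset.sum_congr rfl fun i _ => by ring

/-- **Uniform tails of the weighted rows up to weight `2^{7l}`.** For a smooth `L²` field `w` on `ℝ³` with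
`∑_i T₃(∂_i w) ≤ S₄` and `‖w‖₂ ≤ E₀`, every weight `1 ≤ κ ≤ 7` and every `L`:
`∑_l 2^{κl} ‖Δ̇_l w‖₂² ≤ ∑_{|l|≤L} 2^{κl} ‖Δ̇_l w‖₂² + 2^{−L} · ((C_r⁴ C₂ S₄)² + (C₂ E₀)²)`
(high blocks `2^{κl} a_l² = 2^{(κ−8)l}(2^{4l}a_l)² ≤ 2^{−l}(…)²`; low blocks as in `RiccatiSlice`).
[cite: BahouriCheminDanchin2011, Lemma 2.1] -/
theorem tsum_weighted_sq_le_window_add' {w : EuclideanSpace ℝ (Fin 3) → EuclideanSpace ℝ (Fin 3)}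
    (hw : IsSmoothL2Field w) {S₄ E₀ : ℝ≥0∞}
    (hS₄ : ∑ i, thirdSum (fun x => fderiv ℝ w x (stdOrthonormalBasis ℝ (EuclideanSpace ℝ (Fin 3)) i)) ≤ S₄)
    (hE₀ : eLpNorm w 2 volume ≤ E₀) {κ : ℝ} (hκ1 : 1 ≤ κ) (hκ7 : κ ≤ 7) (L : ℕ) :
    ∑' l : ℤ, (2 : ℝ≥0∞) ^ (κ * (l : ℝ)) * blockL2 w l ^ 2 ≤
      (∑ l ∈ Finset.Icc (-(L : ℤ)) L, (2 : ℝ≥0∞) ^ (κ * (l : ℝ)) * blockL2 w l ^ 2) +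
        (2⁻¹ : ℝ≥0∞) ^ L * ((((lpBounds (Fin 3)).Cr : ℝ≥0∞) ^ 4 * (lpBounds (Fin 3)).C₂ * S₄) ^ 2 +
          ((lpBounds (Fin 3)).C₂ * E₀) ^ 2) := by
  set K := lpBounds (Fin 3) with hK
  have h2 : (2 : ℝ≥0∞) ≠ 0 := two_ne_zero
  have h2' : (2 : ℝ≥0∞) ≠ ∞ := ENNReal.ofNat_ne_top
  set R₁ : ℝ≥0∞ := ((K.Cr : ℝ≥0∞) ^ 4 * K.C₂ * S₄) ^ 2 with hR₁
  set R₂ : ℝ≥0∞ := (K.C₂ * E₀) ^ 2 with hR₂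
  -- high blocks
  have hhigh : ∀ l : ℤ, 0 ≤ l → (2 : ℝ≥0∞) ^ (κ * (l : ℝ)) * blockL2 w l ^ 2 ≤ ((2 : ℝ≥0∞) ^ l)⁻¹ * R₁ := by
    intro l hl
    have hb := (two_pow_four_mul_blockL2_le hw l).trans
      (mul_le_mul' le_rfl hS₄ : (K.Cr : ℝ≥0∞) ^ 4 * K.C₂ * _ ≤ (K.Cr : ℝ≥0∞) ^ 4 * K.C₂ * S₄)
    have h2l0 : (2 : ℝ≥0∞) ^ l ≠ 0 := (ENNReal.zpow_pos h2 h2' l).ne'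
    have h2ltop : (2 : ℝ≥0∞) ^ l ≠ ∞ := ENNReal.zpow_ne_top h2 h2' l
    have hκl : (2 : ℝ≥0∞) ^ (κ * (l : ℝ)) ≤ (2 : ℝ≥0∞) ^ ((7 : ℝ) * (l : ℝ)) :=
      ENNReal.rpow_le_rpow_of_exponent_le (by norm_num)
        (mul_le_mul_of_nonneg_right hκ7 (by exact_mod_cast hl))
    have h7 : (2 : ℝ≥0∞) ^ ((7 : ℝ) * (l : ℝ)) = ((2 : ℝ≥0∞) ^ l)⁻¹ * (((2 : ℝ≥0∞) ^ l) ^ 4) ^ 2 := by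
      rw [two_rpow_mul_intCast, show (7 : ℝ) = ((7 : ℕ) : ℝ) by norm_num, ENNReal.rpow_natCast]
      calc ((2 : ℝ≥0∞) ^ l) ^ 7 = (((2 : ℝ≥0∞) ^ l)⁻¹ * (2 : ℝ≥0∞) ^ l) * ((2 : ℝ≥0∞) ^ l) ^ 7 := by
            rw [ENNReal.inv_mul_cancel h2l0 h2ltop, one_mul]
        _ = ((2 : ℝ≥0∞) ^ l)⁻¹ * (((2 : ℝ≥0∞) ^ l) ^ 4) ^ 2 := by ring
    calc (2 : ℝ≥0∞) ^ (κ * (l : ℝ)) * blockL2 w l ^ 2 ≤ (2 : ℝ≥0∞) ^ ((7 : ℝ) * (l : ℝ)) * blockL2 w l ^ 2 := by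
          gcongr
      _ = ((2 : ℝ≥0∞) ^ l)⁻¹ * (((2 : ℝ≥0∞) ^ l) ^ 4 * blockL2 w l) ^ 2 := by rw [h7]; ring
      _ ≤ ((2 : ℝ≥0∞) ^ l)⁻¹ * R₁ := by rw [hR₁]; gcongr
  refine (LPBounds.tsum_le_sum_Icc_add_tails _ L).trans ?_
  gcongr
  have hinv : ∀ n : ℕ, ((2 : ℝ≥0∞) ^ ((L : ℤ) + 1 + n))⁻¹ = (2⁻¹ : ℝ≥0∞) ^ (L + 1 + n) := fun n => by
    rw [show ((L : ℤ) + 1 + n) = ((L + 1 + n : ℕ) : ℤ) by push_cast; ring, zpow_natCast, ENNReal.inv_pow]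
  have hlow : ∀ n : ℕ, (2 : ℝ≥0∞) ^ (-(L : ℤ) - 1 - n) = (2⁻¹ : ℝ≥0∞) ^ (L + 1 + n) := fun n => by
    rw [show (-(L : ℤ) - 1 - n) = -((L + 1 + n : ℕ) : ℤ) by push_cast; ring, ENNReal.zpow_neg, zpow_natCast,
      ENNReal.inv_pow]
  have hhi : ∑' n : ℕ, (2 : ℝ≥0∞) ^ (κ * (((L : ℤ) + 1 + n : ℤ) : ℝ)) * blockL2 w ((L : ℤ) + 1 + n) ^ 2 ≤
      (2⁻¹ : ℝ≥0∞) ^ L * R₁ := by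
    calc ∑' n : ℕ, (2 : ℝ≥0∞) ^ (κ * (((L : ℤ) + 1 + n : ℤ) : ℝ)) * blockL2 w ((L : ℤ) + 1 + n) ^ 2
        ≤ ∑' n : ℕ, (2⁻¹ : ℝ≥0∞) ^ (L + 1 + n) * R₁ := by
          refine ENNReal.tsum_le_tsum fun n => ?_
          rw [← hinv n]
          exact hhigh _ (by positivity)
      _ = (∑' n : ℕ, (2⁻¹ : ℝ≥0∞) ^ (L + 1 + n)) * R₁ := ENNReal.tsum_mul_right
      _ ≤ (2⁻¹ : ℝ≥0∞) ^ L * R₁ := by gcongr; exact tsum_two_inv_pow_succ_le L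
  have hlo : ∑' n : ℕ, (2 : ℝ≥0∞) ^ (κ * (((-(L : ℤ) - 1 - n : ℤ)) : ℝ)) * blockL2 w (-(L : ℤ) - 1 - n) ^ 2 ≤
      (2⁻¹ : ℝ≥0∞) ^ L * R₂ := by
    calc ∑' n : ℕ, (2 : ℝ≥0∞) ^ (κ * (((-(L : ℤ) - 1 - n : ℤ)) : ℝ)) * blockL2 w (-(L : ℤ) - 1 - n) ^ 2
        ≤ ∑' n : ℕ, (2⁻¹ : ℝ≥0∞) ^ (L + 1 + n) * ((K.C₂ * eLpNorm w 2 volume) ^ 2) := by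
          refine ENNReal.tsum_le_tsum fun n => ?_
          rw [← hlow n]
          exact weighted_sq_le_of_nonpos hw.memLp_two hκ1 (by omega)
      _ = (∑' n : ℕ, (2⁻¹ : ℝ≥0∞) ^ (L + 1 + n)) * (K.C₂ * eLpNorm w 2 volume) ^ 2 := ENNReal.tsum_mul_right
      _ ≤ (2⁻¹ : ℝ≥0∞) ^ L * R₂ := by
          rw [hR₂]
          gcongr
          exact tsum_two_inv_pow_succ_le L
  calc (∑' n : ℕ, (2 : ℝ≥0∞) ^ (κ * (((L : ℤ) + 1 + n : ℤ) : ℝ)) * blockL2 w ((L : ℤ) + 1 + n) ^ 2) +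
        ∑' n : ℕ, (2 : ℝ≥0∞) ^ (κ * (((-(L : ℤ) - 1 - n : ℤ)) : ℝ)) * blockL2 w (-(L : ℤ) - 1 - n) ^ 2
      ≤ (2⁻¹ : ℝ≥0∞) ^ L * R₁ + (2⁻¹ : ℝ≥0∞) ^ L * R₂ := add_le_add hhi hlo
    _ = (2⁻¹ : ℝ≥0∞) ^ L * (R₁ + R₂) := (mul_add _ _ _).symm

/-- The third-derivative sums of the first derivatives of a smooth `L²` field are finite. [folklore] -/
theorem sum_thirdSum_fderiv_ne_top {w : EuclideanSpace ℝ (Fin 3) → EuclideanSpace ℝ (Fin 3)}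
    (hw : IsSmoothL2Field w) :
    ∑ i, thirdSum (fun x => fderiv ℝ w x (stdOrthonormalBasis ℝ (EuclideanSpace ℝ (Fin 3)) i)) ≠ ∞ :=
  ENNReal.sum_ne_top.2 fun _ _ => thirdSum_ne_top (hw.fderiv_apply _)

/-- The weighted rows `1 ≤ κ ≤ 7` of a smooth `L²` field are finite. [folklore] -/
theorem tsum_weighted_sq_ne_top' {w : EuclideanSpace ℝ (Fin 3) → EuclideanSpace ℝ (Fin 3)}
    (hw : IsSmoothL2Field w) {κ : ℝ} (hκ1 : 1 ≤ κ) (hκ7 : κ ≤ 7) :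
    ∑' l : ℤ, (2 : ℝ≥0∞) ^ (κ * (l : ℝ)) * blockL2 w l ^ 2 ≠ ∞ := by
  have h := tsum_weighted_sq_le_window_add' hw le_rfl le_rfl hκ1 hκ7 0
  refine ne_top_of_le_ne_top ?_ h
  refine ENNReal.add_ne_top.2 ⟨?_, ?_⟩
  · exact ENNReal.sum_ne_top.2 fun l _ => ENNReal.mul_ne_top (RiccatiSlice.two_rpow_ne_top _)
      (ENNReal.pow_ne_top ((hw.blockFn l).memLp_two).eLpNorm_ne_top)
  · exact ENNReal.mul_ne_top (ENNReal.pow_ne_top (by norm_num))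
      (ENNReal.add_ne_top.2 ⟨ENNReal.pow_ne_top (ENNReal.mul_ne_top (ENNReal.mul_ne_top
        (ENNReal.pow_ne_top ENNReal.coe_ne_top) ENNReal.coe_ne_top) (sum_thirdSum_fderiv_ne_top hw)),
        ENNReal.pow_ne_top (ENNReal.mul_ne_top ENNReal.coe_ne_top hw.memLp_two.eLpNorm_ne_top)⟩)

/-! ## Hölder over the levels and Young -/

/-- **Hölder over the levels**: for `3 < κ < 5` and any `a : ℤ → [0,∞]`,
`∑_l 32^l a_l² ≤ (∑_l 2^{κl} a_l²)^{(κ−3)/2} · (∑_l 2^{(κ+2)l} a_l²)^{(5−κ)/2}` (`32^l = (2^{κl})^{θ}(2^{(κ+2)l})^{α}` with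
`θ = (κ−3)/2`, `α = (5−κ)/2`, `θ + α = 1`; Hölder on the counting measure with exponents `1/θ`, `1/α`).
[cite: CheskidovZaya2016, Remark 2.3] -/
theorem tsum_five_le_rpow_mul_rpow {κ : ℝ} (hκ3 : 3 < κ) (hκ5 : κ < 5) (a : ℤ → ℝ≥0∞) :
    ∑' l : ℤ, (2 : ℝ≥0∞) ^ ((5 : ℝ) * (l : ℝ)) * a l ^ 2 ≤
      (∑' l : ℤ, (2 : ℝ≥0∞) ^ (κ * (l : ℝ)) * a l ^ 2) ^ ((κ - 3) / 2) *
        (∑' l : ℤ, (2 : ℝ≥0∞) ^ ((κ + 2) * (l : ℝ)) * a l ^ 2) ^ ((5 - κ) / 2) := by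
  set θ : ℝ := (κ - 3) / 2 with hθ
  set α : ℝ := (5 - κ) / 2 with hα
  have hθ0 : 0 < θ := by rw [hθ]; linarith
  have hα0 : 0 < α := by rw [hα]; linarith
  have hθα : θ + α = 1 := by rw [hθ, hα]; ring
  have hpq : (1 / θ).HolderConjugate (1 / α) := by
    rw [Real.holderConjugate_iff]
    refine ⟨by rw [one_div, one_lt_inv_iff₀]; exact ⟨hθ0, by linarith⟩, ?_⟩
    rw [one_div, one_div, inv_inv, inv_inv, hθα]
  set f : ℤ → ℝ≥0∞ := fun l => ((2 : ℝ≥0∞) ^ (κ * (l : ℝ)) * a l ^ 2) ^ θ with hf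
  set g : ℤ → ℝ≥0∞ := fun l => ((2 : ℝ≥0∞) ^ ((κ + 2) * (l : ℝ)) * a l ^ 2) ^ α with hg
  have hH := ENNReal.lintegral_mul_le_Lp_mul_Lq (Measure.count : Measure ℤ) hpq
    (f := f) (g := g) (Measurable.of_discrete.aemeasurable) (Measurable.of_discrete.aemeasurable)
  simp only [lintegral_count, Pi.mul_apply] at hH
  have hfg : ∀ l : ℤ, f l * g l = (2 : ℝ≥0∞) ^ ((5 : ℝ) * (l : ℝ)) * a l ^ 2 := by
    intro l
    simp only [hf, hg]
    rw [ENNReal.mul_rpow_of_nonneg _ _ hθ0.le, ENNReal.mul_rpow_of_nonneg _ _ hα0.le, ← ENNReal.rpow_mul,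
      ← ENNReal.rpow_mul]
    calc (2 : ℝ≥0∞) ^ (κ * (l : ℝ) * θ) * (a l ^ 2) ^ θ * ((2 : ℝ≥0∞) ^ ((κ + 2) * (l : ℝ) * α) * (a l ^ 2) ^ α)
        = ((2 : ℝ≥0∞) ^ (κ * (l : ℝ) * θ) * (2 : ℝ≥0∞) ^ ((κ + 2) * (l : ℝ) * α)) *
            ((a l ^ 2) ^ θ * (a l ^ 2) ^ α) := by ring
      _ = (2 : ℝ≥0∞) ^ ((5 : ℝ) * (l : ℝ)) * a l ^ 2 := by
          rw [← two_rpow_add, ← ENNReal.rpow_add_of_nonneg _ _ hθ0.le hα0.le, hθα, ENNReal.rpow_one]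
          congr 1; congr 1; rw [hθ, hα]; ring
  have hf1 : ∀ l : ℤ, f l ^ (1 / θ) = (2 : ℝ≥0∞) ^ (κ * (l : ℝ)) * a l ^ 2 := fun l => by
    simp only [hf]; rw [← ENNReal.rpow_mul, mul_one_div_cancel hθ0.ne', ENNReal.rpow_one]
  have hg1 : ∀ l : ℤ, g l ^ (1 / α) = (2 : ℝ≥0∞) ^ ((κ + 2) * (l : ℝ)) * a l ^ 2 := fun l => by
    simp only [hg]; rw [← ENNReal.rpow_mul, mul_one_div_cancel hα0.ne', ENNReal.rpow_one]
  simp_rw [hfg, hf1, hg1, one_div_one_div] at hH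
  exact hH

/-- **Young with an `ε`**: for reals `U, V ≥ 0`, `ε > 0` and `0 < α < 2`,
`U · V^{α/2} ≤ ε V + ε^{−α/(2−α)} U^{2/(2−α)}` (Young with exponents `2/(2−α)`, `2/α` applied to
`(U ε^{−α/2}) · (ε^{α/2} V^{α/2})`). [folklore] -/
theorem young_rpow {U V ε α : ℝ} (hU : 0 ≤ U) (hV : 0 ≤ V) (hε : 0 < ε) (hα0 : 0 < α) (hα2 : α < 2) :
    U * V ^ (α / 2) ≤ ε * V + ε ^ (-(α / (2 - α))) * U ^ (2 / (2 - α)) := by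
  set P : ℝ := 2 / (2 - α) with hP
  set Q : ℝ := 2 / α with hQ
  have h2α : 0 < 2 - α := by linarith
  have hP1 : 1 < P := by rw [hP, lt_div_iff₀ h2α]; linarith
  have hQ1 : 1 < Q := by rw [hQ, lt_div_iff₀ hα0]; linarith
  have hPQ : P.HolderConjugate Q := by
    rw [Real.holderConjugate_iff]
    refine ⟨hP1, ?_⟩
    rw [hP, hQ]
    field_simp
    ring
  set A : ℝ := U * ε ^ (-(α / 2)) with hA
  set B : ℝ := ε ^ (α / 2) * V ^ (α / 2) with hB
  have hA0 : 0 ≤ A := mul_nonneg hU (Real.rpow_nonneg hε.le _)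
  have hB0 : 0 ≤ B := mul_nonneg (Real.rpow_nonneg hε.le _) (Real.rpow_nonneg hV _)
  have hAB : A * B = U * V ^ (α / 2) := by
    rw [hA, hB]
    calc U * ε ^ (-(α / 2)) * (ε ^ (α / 2) * V ^ (α / 2)) = U * (ε ^ (-(α / 2)) * ε ^ (α / 2)) * V ^ (α / 2) := by
          ring
      _ = U * V ^ (α / 2) := by rw [← Real.rpow_add hε, neg_add_cancel, Real.rpow_zero, mul_one]
  have hyoung := Real.young_inequality_of_nonneg hA0 hB0 hPQ
  -- `A^P = ε^{-α/(2-α)} U^P`, `B^Q = ε V`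
  have hAP : A ^ P = ε ^ (-(α / (2 - α))) * U ^ P := by
    rw [hA, Real.mul_rpow hU (Real.rpow_nonneg hε.le _), ← Real.rpow_mul hε.le, mul_comm]
    congr 2
    rw [hP]; field_simp
  have hBQ : B ^ Q = ε * V := by
    rw [hB, Real.mul_rpow (Real.rpow_nonneg hε.le _) (Real.rpow_nonneg hV _), ← Real.rpow_mul hε.le,
      ← Real.rpow_mul hV]
    have e : α / 2 * Q = 1 := by rw [hQ]; field_simp
    rw [e, Real.rpow_one, Real.rpow_one]
  rw [← hAB]
  calc A * B ≤ A ^ P / P + B ^ Q / Q := hyoung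
    _ ≤ A ^ P + B ^ Q := by
        have h1 : A ^ P / P ≤ A ^ P := div_le_self (Real.rpow_nonneg hA0 _) hP1.le
        have h2 : B ^ Q / Q ≤ B ^ Q := div_le_self (Real.rpow_nonneg hB0 _) hQ1.le
        linarith
    _ = ε * V + ε ^ (-(α / (2 - α))) * U ^ P := by rw [hAP, hBQ]; ring

end Summit.NavierStokesRegularity.FluidComputer.RiccatiSliceGenTools

end
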